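import Summits.CriticalPhenomena.PercolationContinuityZ3.Theorems.PercNearOneGluingAdditiveGluingAL5TwoRelaysGeneral
import HarnessLib

/-! # Crux `PercNearOneGluing.AdditiveGluing` (stmt-CriticalPhenomena-4576) — AL5 for small relay-neighbour sets

Support file (`--supports stmt-CriticalPhenomena-4576`; task png-dp-al5); no definitions, no named facts.  Notation of
`…AL5Layers.lean` / `…AL5TwoRelaysGeneral.lean`: `μ_w = prodBernoulli w`, target `b`, bystander `x`, glued block
`w^S := fun e => if e ∈ S.image (s(x,·)) then 1 else w e`, relay neighbours `T`, `R = {ω | ∃ a ∈ T, s(x,a) ∈ ω}`;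
AL5: `μ_{w^S}(R ∩ {d ↔ b}) ≤ μ_{w^S}(R ∩ {x ↔ b})` under `τ_w(d) ≤ τ_w(a)` (`a ∈ T`, hypothesis in the UN-glued `w`).

This file assembles the rungs of the AL5 ladder that are now closed for EVERY block `S` and EVERY neighbourhood of the
bystander, in the exact shape of the registered rung statements (`stub_al5Rung2_dp`, `stub_al5Rung3_dp`: arbitrary `T`
with `x ∉ T`, `S ∩ T = ∅`): `al5_of_card_le_two` (`T.card ≤ 2`: `T = ∅` trivial, `|T| = 1` = `al5_singleRelay`,
`|T| = 2` = `al5_twoRelays_general`) and `al5_of_card_erase_le_two` (`(T.erase d).card ≤ 2`, the layer of the edge `x–d`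
contributing equally to both sides).  What remains open of the registered rungs is `|T ∖ {d}| ≥ 3`.
[cite: KozmaNitzan2024, Lemma 3(i) (pp. 6–7), Lemma 5 (p. 13)]
-/

namespace Summit.CriticalPhenomena.PercolationContinuityZ3.Theorems

open MeasureTheory Set
open Literature.Probability.LatticeModels (prodBernoulli)
open Literature.Probability.Percolation (BondConfig openConn openConnIn openGraph openEdgeCluster pinW localCylinder)

noncomputable section
open Classical

section AL5SmallRelaySets

open Filter Topology Literature.Probability.LatticeModels Literature.Probability.Percolation

variable {n : ℕ}

/-- **AL5 for every block with at most two relay neighbours** (any neighbourhood of the bystander): `x ∉ S ∪ T`,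
`S ∩ T = ∅`, `T.card ≤ 2`, `τ_w(d) ≤ τ_w(a)` for `a ∈ T` ⟹ `μ_{w^S}(R ∩ {d ↔ b}) ≤ μ_{w^S}(R ∩ {x ↔ b})`.  Cases
`T = ∅` (both sides vanish), `T = {a}` (`al5_singleRelay`), `T = {a₁, a₂}` (`al5_twoRelays_general`).
[cite: KozmaNitzan2024, Lemma 3(i) (pp. 6–7), Lemma 5 (p. 13)] -/
theorem al5_of_card_le_two (w : Sym2 (Fin n) → unitInterval) (S T : Finset (Fin n)) (x d b : Fin n)
    (hS : ∀ y ∈ S, y ≠ x) (hxT : x ∉ T) (hST : Disjoint S T) (hT : T.card ≤ 2)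
    (hle : ∀ a ∈ T, (prodBernoulli w).real (openConn d b) ≤ (prodBernoulli w).real (openConn a b)) :
    (prodBernoulli (fun e : Sym2 (Fin n) => if e ∈ S.image (fun y => s(x, y)) then 1 else w e)).real
        ({ω : Set (Sym2 (Fin n)) | ∃ a ∈ T, s(x, a) ∈ ω} ∩ openConn d b) ≤
      (prodBernoulli (fun e : Sym2 (Fin n) => if e ∈ S.image (fun y => s(x, y)) then 1 else w e)).real
        ({ω : Set (Sym2 (Fin n)) | ∃ a ∈ T, s(x, a) ∈ ω} ∩ openConn x b) := by
  obtain h | h | h : T.card = 0 ∨ T.card = 1 ∨ T.card = 2 := by omega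
  · rw [Finset.card_eq_zero] at h
    subst h
    have hR : {ω : Set (Sym2 (Fin n)) | ∃ a ∈ (∅ : Finset (Fin n)), s(x, a) ∈ ω} = ∅ := by
      ext ω
      simp only [Finset.notMem_empty, false_and, exists_false, Set.mem_setOf_eq, Set.mem_empty_iff_false]
    rw [hR, Set.empty_inter, Set.empty_inter]
  · obtain ⟨a, rfl⟩ := Finset.card_eq_one.1 h
    have hax : a ≠ x := fun hax => hxT (by rw [hax]; exact Finset.mem_singleton_self x)
    exact al5_singleRelay w S x d b a hS hax (hle a (Finset.mem_singleton_self a))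
  · obtain ⟨a₁, a₂, h12, rfl⟩ := Finset.card_eq_two.1 h
    have ha₁T : a₁ ∈ ({a₁, a₂} : Finset (Fin n)) := by simp
    have ha₂T : a₂ ∈ ({a₁, a₂} : Finset (Fin n)) := by simp
    have ha₁x : a₁ ≠ x := fun h' => hxT (h' ▸ ha₁T)
    have ha₂x : a₂ ≠ x := fun h' => hxT (h' ▸ ha₂T)
    have ha₁S : a₁ ∉ S := Finset.disjoint_right.1 hST ha₁T
    have ha₂S : a₂ ∉ S := Finset.disjoint_right.1 hST ha₂T
    exact al5_twoRelays_general w S x d b a₁ a₂ hS ha₁x ha₂x h12 ha₁S ha₂S (hle a₁ ha₁T) (hle a₂ ha₂T)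

/-- **AL5 for every block when, apart from `d` itself, the bystander has at most two relay neighbours**:
`(T.erase d).card ≤ 2` (the relay layer of the edge `x–d` contributes equally to both sides, `al5_dropRelay`).
[cite: KozmaNitzan2024, Lemma 3(i) (pp. 6–7), Lemma 5 (p. 13)] -/
theorem al5_of_card_erase_le_two (w : Sym2 (Fin n) → unitInterval) (S T : Finset (Fin n)) (x d b : Fin n)
    (hS : ∀ y ∈ S, y ≠ x) (hxT : x ∉ T) (hST : Disjoint S T) (hT : (T.erase d).card ≤ 2)
    (hle : ∀ a ∈ T, (prodBernoulli w).real (openConn d b) ≤ (prodBernoulli w).real (openConn a b)) :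
    (prodBernoulli (fun e : Sym2 (Fin n) => if e ∈ S.image (fun y => s(x, y)) then 1 else w e)).real
        ({ω : Set (Sym2 (Fin n)) | ∃ a ∈ T, s(x, a) ∈ ω} ∩ openConn d b) ≤
      (prodBernoulli (fun e : Sym2 (Fin n) => if e ∈ S.image (fun y => s(x, y)) then 1 else w e)).real
        ({ω : Set (Sym2 (Fin n)) | ∃ a ∈ T, s(x, a) ∈ ω} ∩ openConn x b) := by
  by_cases hdx : d = x
  · subst hdx
    exact le_rfl
  refine al5_dropRelay _ T x d b hdx ?_
  exact al5_of_card_le_two w S (T.erase d) x d b hS (fun h => hxT (Finset.mem_of_mem_erase h))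
    (Finset.disjoint_of_subset_right (Finset.erase_subset d T) hST) hT
    (fun a ha => hle a (Finset.mem_of_mem_erase ha))


end AL5SmallRelaySets

end

end Summit.CriticalPhenomena.PercolationContinuityZ3.Theorems
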